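import Literature.NumberTheory.EllipticCurves.ZpExtensionEisensteinTwistFixedPointBoundProofs
import Literature.NumberTheory.EllipticCurves.IwasawaAlgebraEisensteinTorsionExactProofs
import Literature.NumberTheory.GaloisRepresentations.LocalEulerCharCoprime
import Literature.NumberTheory.GaloisRepresentations.LocalDualityDescent
import Literature.NumberTheory.GaloisRepresentations.LocalGlobalCohomologyDualityProofs
import Literature.NumberTheory.GaloisRepresentations.LocalGlobalCohomologyFiniteProofs
import Literature.NumberTheory.GaloisRepresentations.TameInertia
import Literature.NumberTheory.GaloisRepresentations.CohomologicalDimension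
import Literature.NumberTheory.EllipticCurves.TowerTorsionAnnihilatorProofs
import Literature.NumberTheory.EllipticCurves.GreenbergSelmer
import Literature.GroupTheory.PadicIntCompactImageProofs
import HarnessLib

/-!
# `#H¹(F, E[p^j] ⊗ A_{m,j}(ψ))` is bounded UNIFORMLY in `j` at a finitely decomposed place of residue characteristic
# `≠ p` (Howard H.4 at `v ∣ N`; proofs)

`Proofs` file (theorems only; no definition, no named fact, no instance) in topic `NumberTheory/EllipticCurves`.

Setting: `K` a field, `E = W/K` an elliptic curve, `p` a prime with `p ≠ 0` in `K`, `κ : Γ_K ↠ ℤ_p` a `ℤ_p`-extension,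
Howard's Eisenstein levels `W_{m,j} = E[p^j] ⊗ A_{m,j}(ψ)` (`ZpExtension.eisensteinTwist`, [Howard 2004] §2.2), and a
`K`-field `F` which is a non-archimedean local field of characteristic `0` with residue characteristic `≠ p` (e.g.
`F = K_v`, `v ∤ p`) such that SOME `h ∈ Γ_F` maps to `σ₀ ∈ Γ_K` with `κ(σ₀) = N ∈ ℕ_{≥1}` (`v` finitely decomposed in
`K_∞`; for an anticyclotomic `κ` and `v` split in the imaginary quadratic `K` this is the tree's
`AnticyclotomicPrimeDecomposition*`).  Then for `m > 2N`:

* §1 (counting duals) `natCard_subtype_comp_eq_zero_le`: for a finite `M` killed by `n`, an endomorphism `g` and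
  `Ω ↪ ℤ/n`, `#{f : M →+ Ω // f ∘ g = 0} ≤ #ker g` (`f` factors through `M/g(M)`, `#Hom(M/g(M), ℤ/n) = #(M/g(M)) =
  #ker g`).
* §2 (one element bounds local invariants) `natCard_invariants_restrictField_le_natCard_setOf`: `#M^{Γ_F} ≤
  #{x : σ₀ x = x}`; `mu_apply_eq_cyclotomicCharacterModPow_val_nsmul`: `h · ξ = χ̄_j(h) • ξ` on `μ_{p^j}`;
  `natCard_invariants_homRep_mu_restrictField_le`: `#Hom_{Γ_F}(M, μ_{p^j}) ≤ #{x : σ₀ x = χ̄_j(h) • x}`.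
* §3 **`ZpExtension.exists_natCard_galoisCohomology_one_restrictField_eisensteinTwist_le`**: there is `C` with
  `#H¹(F, W_{m,j}) ≤ C` for ALL `j ≥ 1` — Tate's local Euler characteristic in the prime-to-`p` case PROVED in the tree
  (`natCard_one_eq_natCard_invariants_mul`: `#H¹ = #H⁰ · #Hom_{Γ_F}(·, μ)`, Milne I 2.8) and the `j`-uniform
  eigenvector bounds of `ZpExtensionEisensteinTwistFixedPointBoundProofs` (`ℓ = 1` and `ℓ = χ_cyc(h)`); and
  **`exists_pow_smul_galoisCohomology_one_restrictField_eisensteinTwist_eq_zero`**: `p^c · H¹(F, W_{m,j}) = 0` for all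
  `j ≥ 1` — the inputs (hTX)/(hTY) of the tree's `Tower.levelCondition_mem_iff_forall_pairing_eq_zero_of_forall_nsmul_eq_zero`
  (the saturated level conditions of `F_𝔮` at `v ∣ N` are self-orthogonal, hypothesis H.4 of [Howard 2004]).
* §4 packaging: from ONE `h₀ ∈ Γ_F` with `κ(h₀) ≠ 1` the image of the compact `Γ_F` in `ℤ_p` is `p^e ℤ_p`
  (`Literature.GroupTheory.kappa_eq_one_or_exists_image_eq_span_pow`), so some `h` has `κ(h) = p^e`
  (`exists_toAdd_apply_absGaloisRestrict_eq_pow`) and the torsion bound holds for every `m > 2 p^e`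
  (`exists_forall_pow_smul_galoisCohomology_one_eq_zero_of_apply_ne_one`); at a finite place `v ∤ p` of a number
  field NOT splitting completely in `K_∞` (`¬ D_v ≤ ker κ`, the tree's `GreenbergSelmer.decomp` / Brink 2007 for split
  `v` in the anticyclotomic tower): **`exists_forall_pow_smul_galoisCohomology_one_toLocal_eq_zero`** for
  `H¹(K_v, E[p^j] ⊗ A_{m,j}(ψ))` (`GaloisRep.toLocal v`).

No reduction type of `E` enters.  References: [Howard2004HeegnerKolyvagin] B. Howard, Compositio Math. 140 (2004), §1.3
H.4, §2.2, Def. 3.1.2; [MilneADT2006] J. S. Milne, *Arithmetic Duality Theorems*, I Thm. 2.8, Cor. 2.3;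
[GreenbergLNM1716] R. Greenberg, LNM 1716, proof of Prop. 4.15. BSD is not proved by any of this.
-/

noncomputable section

open Field IsNonarchimedeanLocalField ValuativeRel
open scoped Classical

universe u v

namespace Literature.NumberTheory.EllipticCurves

open Literature.NumberTheory.GaloisRepresentations Literature.NumberTheory.GaloisRepresentations.DiscreteGaloisModule
  IwasawaAlgebra IwasawaAlgebra.EisensteinCoeff Literature.Algebra.Module

/-! ## §1 Counting homomorphisms that kill the image of an endomorphism -/

/-- For an endomorphism `g` of a FINITE abelian group, `#(M/g(M)) = #ker g`. [cite: MilneADT2006, I §0 (finite modules; folklore counting)] -/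
theorem natCard_quotient_range_eq_natCard_ker_addMonoidHom {M : Type u} [AddCommGroup M] [Finite M] (g : M →+ M) :
    Nat.card (M ⧸ g.range) = Nat.card g.ker := by
  have h1 := AddSubgroup.card_eq_card_quotient_mul_card_addSubgroup g.ker
  have h2 := AddSubgroup.card_eq_card_quotient_mul_card_addSubgroup g.range
  have h3 : Nat.card (M ⧸ g.ker) = Nat.card g.range := Nat.card_congr (QuotientAddGroup.quotientKerEquivRange g).toEquiv
  rw [h3] at h1
  have hpos : 0 < Nat.card g.range := Nat.card_pos
  rw [h1, mul_comm (Nat.card (M ⧸ g.range))] at h2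
  exact (Nat.eq_of_mul_eq_mul_left hpos h2).symm

/-- **`#{f : M →+ Ω // f ∘ g = 0} ≤ #ker g`** for `M` finite killed by `n` and `Ω` embedding in `ℤ/n`: such `f` factor
through `M/g(M)`, and `#Hom(M/g(M), ℤ/n) = #(M/g(M)) = #ker g`. [cite: MilneADT2006, I §0 (finite modules and their duals)] -/
theorem natCard_subtype_comp_eq_zero_le {M : Type u} {Ω : Type v} [AddCommGroup M] [AddCommGroup Ω] [Finite M]
    (g : M →+ M) {n : ℕ} [NeZero n] (hM : ∀ x : M, n • x = 0) (ι : Ω →+ ZMod n) (hι : Function.Injective ι) :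
    Nat.card {f : M →+ Ω // ∀ x, f (g x) = 0} ≤ Nat.card g.ker := by
  -- every such `f` factors through `M ⧸ g(M)`
  have hfac : ∀ f : {f : M →+ Ω // ∀ x, f (g x) = 0}, g.range ≤ f.1.ker := fun f ↦ by
    rintro _ ⟨x, rfl⟩
    exact f.2 x
  let Φ : {f : M →+ Ω // ∀ x, f (g x) = 0} → (M ⧸ g.range →+ ZMod n) :=
    fun f ↦ ι.comp (QuotientAddGroup.lift g.range f.1 (hfac f))
  have hΦ : Function.Injective Φ := by
    intro f₁ f₂ h12
    apply Subtype.ext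
    ext x
    have := DFunLike.congr_fun h12 (QuotientAddGroup.mk x)
    simp only [Φ, AddMonoidHom.coe_comp, Function.comp_apply, QuotientAddGroup.lift_mk] at this
    exact hι this
  haveI : Finite (M ⧸ g.range →+ ZMod n) := Finite.of_injective _ DFunLike.coe_injective
  have hQ : ∀ q : M ⧸ g.range, n • q = 0 := fun q ↦ by
    induction q using QuotientAddGroup.induction_on with
    | H x => rw [← QuotientAddGroup.mk_nsmul, hM, QuotientAddGroup.mk_zero]
  calc Nat.card {f : M →+ Ω // ∀ x, f (g x) = 0}
      ≤ Nat.card (M ⧸ g.range →+ ZMod n) := Nat.card_le_card_of_injective Φ hΦ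
    _ = Nat.card (M ⧸ g.range) := Nat.card_addMonoidHom_zmod hQ
    _ = Nat.card g.ker := natCard_quotient_range_eq_natCard_ker_addMonoidHom g

/-! ## §2 One element of the local Galois group bounds the local invariants -/

section OneElement

variable {K : Type u} [Field K] {M : Type u} [AddCommGroup M] [TopologicalSpace M] [DiscreteTopology M] [Finite M]
  (ρ : DiscreteGaloisModule K M) (F : Type u) [Field F] [Algebra K F] (h : absoluteGaloisGroup F)

/-- **`#M^{Γ_F} ≤ #{x : σ₀ x = x}`** for `σ₀` the image in `Γ_K` of any `h ∈ Γ_F`. [cite: MilneADT2006, I §2 (local invariants)] -/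
theorem natCard_invariants_restrictField_le_natCard_setOf :
    Nat.card (GaloisRep.restrictField F ρ).toTopRep.ρ.invariants ≤
      Nat.card {x : M | ρ (absGaloisRestrict K F h) x = x} := by
  refine Nat.card_mono (Set.toFinite _) fun x hx ↦ ?_
  have := (Representation.mem_invariants _ x).1 hx h
  exact this

/-- **`h · ξ = χ̄_j(h) • ξ` on `μ_{p^j}(F̄)`** (additive notation; `χ̄_j = cyclotomicCharacterModPow F p j`, through its
value in `ℕ`). [cite: SerreGaloisCohomology1997, Ch. II §1.2] -/
theorem mu_apply_eq_cyclotomicCharacterModPow_val_nsmul {p : ℕ} [Fact p.Prime] [NeZero (p : F)] (j : ℕ)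
    (v : MuCarrier F (p ^ j)) : mu F (p ^ j) h v = (cyclotomicCharacterModPow F p j h).val • v := by
  apply muVal_injective F (p ^ j)
  rw [muVal_apply, muVal_nsmul]
  have h1 : ((muVal F (p ^ j) v : (AlgebraicClosure F)ˣ) : AlgebraicClosure F) ^ p ^ j = 1 := by
    rw [← Units.val_pow_eq_pow_val, muVal_pow_eq_one, Units.val_one]
  have hspec := GaloisRep.cyclotomicCharacter_spec F p (k := j) h _ h1
  have hc : ((GaloisRep.cyclotomicCharacter F p h).val.toZModPow j).val = (cyclotomicCharacterModPow F p j h).val := by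
    rw [cyclotomicCharacterModPow_apply]
  ext
  rw [Units.coe_smul, hspec, hc, Units.val_pow_eq_pow_val]

/-- **`#Hom_{Γ_F}(M, μ_n) ≤ #{x : σ₀ x = c • x}`** whenever `h · ξ = c • ξ` on `μ_n(F̄)` and `n M = 0`, for `σ₀` the image of
`h ∈ Γ_F`: an equivariant `f` satisfies `f(σ₀ x) = c • f(x) = f(c • x)`, so it kills the image of `σ₀ - c`, and
`#{f : f ∘ (σ₀ - c) = 0} ≤ #ker(σ₀ - c)` (`natCard_subtype_comp_eq_zero_le`; `μ_n(F̄) ≃ ℤ/n` in characteristic `0`).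
[cite: MilneADT2006, I §2 (M^D = Hom(M, μ), local invariants)] -/
theorem natCard_invariants_homRep_mu_restrictField_le [CharZero F] {n : ℕ} [NeZero n] (hM : ∀ x : M, n • x = 0)
    {c : ℕ} (hc : ∀ v : MuCarrier F n, mu F n h v = c • v) :
    Nat.card ((GaloisRep.restrictField F ρ).homRep (mu F n)).toTopRep.ρ.invariants ≤
      Nat.card {x : M | ρ (absGaloisRestrict K F h) x = c • x} := by
  -- the endomorphism `σ₀ - c`
  set g : M →+ M := (ρ (absGaloisRestrict K F h)).toAddMonoidHom - c • AddMonoidHom.id M with hg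
  have hker : Nat.card g.ker = Nat.card {x : M | ρ (absGaloisRestrict K F h) x = c • x} := by
    refine Nat.card_congr (Equiv.subtypeEquivRight fun x ↦ ?_)
    rw [AddMonoidHom.mem_ker, hg, AddMonoidHom.sub_apply, sub_eq_zero]
    rfl
  rw [← hker]
  -- invariants embed into `{f : M →+ μ_n // f ∘ g = 0}`
  have hsub : ∀ f : ((GaloisRep.restrictField F ρ).homRep (mu F n)).toTopRep.ρ.invariants, ∀ x : M,
      (f.1 : M →+ MuCarrier F n) (g x) = 0 := fun f x ↦ by
    have hf := (Representation.mem_invariants _ f.1).1 f.2 h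
    have hfx := ((ContinuousRep.homRep_apply_eq_self_iff _ _ h f.1).1 hf) x
    rw [hg, AddMonoidHom.sub_apply, map_sub, sub_eq_zero, AddMonoidHom.smul_apply, AddMonoidHom.id_apply, map_nsmul]
    change (f.1 : M →+ MuCarrier F n) (ρ (absGaloisRestrict K F h) x) = c • (f.1 : M →+ MuCarrier F n) x
    rw [← hc]
    exact hfx.symm
  have hinj : Function.Injective (fun f : ((GaloisRep.restrictField F ρ).homRep (mu F n)).toTopRep.ρ.invariants ↦
      (⟨(f.1 : M →+ MuCarrier F n), hsub f⟩ : {f : M →+ MuCarrier F n // ∀ x, f (g x) = 0})) := by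
    intro f₁ f₂ h12
    simp only [Subtype.mk.injEq] at h12
    exact Subtype.ext h12
  haveI : Finite (MuCarrier F n) := Finite.of_injective _ (muEquivZMod F n).injective
  haveI : Finite (M →+ MuCarrier F n) := Finite.of_injective _ DFunLike.coe_injective
  refine (Nat.card_le_card_of_injective _ hinj).trans ?_
  exact natCard_subtype_comp_eq_zero_le g hM ((muEquivZMod F n : MuCarrier F n ≃+ ZMod n) : MuCarrier F n →+ ZMod n)
    (muEquivZMod F n).injective

end OneElement

/-! ## §3 The uniform bound on `#H¹(F, E[p^j] ⊗ A_{m,j}(ψ))` -/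

namespace ZpExtension

variable {K : Type u} [Field K] (W : WeierstrassCurve K) [W.IsElliptic] {p : ℕ} [hp : Fact p.Prime]
  (κ : ZpExtension K p) {m : ℕ} (hm : 1 ≤ m)
  (F : Type u) [Field F] [Algebra K F] [CharZero F] [ValuativeRel F] [TopologicalSpace F] [IsNonarchimedeanLocalField F]

/-- **Uniform bound on `#H¹(F, E[p^j] ⊗ A_{m,j}(ψ))`.**  Let `F` be a `K`-field which is a non-archimedean local field of
characteristic `0` with residue characteristic not dividing `p` (e.g. `F = K_v`, `v ∤ p`), `h ∈ Γ_F` an element whose image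
`σ₀ ∈ Γ_K` has `κ(σ₀) = N ≥ 1`, and `m > 2N`.  Then there is `C` with `#H¹(F, E[p^j] ⊗ A_{m,j}(ψ)) ≤ C` for EVERY `j ≥ 1`
(`#H¹ = #H⁰ · #Hom_{Γ_F}(·, μ_{p^j})` by the prime-to-`p` local Euler characteristic, Milne I 2.8, and both factors are
bounded by the `j`-uniform eigenvector counts of one element). [cite: Howard2004HeegnerKolyvagin, §1.3 H.4 and §2.2]
[cite: MilneADT2006, I Thm. 2.8 and Cor. 2.3] [cite: GreenbergLNM1716, proof of Prop. 4.15] -/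
theorem exists_natCard_galoisCohomology_one_restrictField_eisensteinTwist_le (hpK : (p : K) ≠ 0)
    (hFp : ¬ ringChar 𝓀[F] ∣ p) (h : absoluteGaloisGroup F) {N : ℕ} (hN : 1 ≤ N)
    (hσ : (κ (absGaloisRestrict K F h)).toAdd = (N : ℤ_[p])) (hmN : 2 * N < m) :
    ∃ C : ℕ, ∀ (j : ℕ), 1 ≤ j →
      Nat.card (galoisCohomology (GaloisRep.restrictField F
        (κ.eisensteinTwist (W.torsionGaloisModule ((p : ℤ) ^ j)) hm j)) 1) ≤ C := by
  have hpp := hp.out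
  haveI : NeZero (p : F) := ⟨fun h0 ↦ hpK (by
    have := congrArg (algebraMap K F) (rfl : (p : K) = p)
    exact (algebraMap K F).injective.eq_iff.mp (by rw [map_natCast, map_zero, h0]))⟩
  obtain ⟨a₁, a₀, ha₀, hD⟩ := κ.natCard_setOf_eisensteinTwist_apply_eq_smul_le W hm hpK hN hσ hmN
  -- the two `j`-independent constants: `ℓ = 1` (invariants) and `ℓ = χ_cyc(h)` (equivariant characters)
  set χ : ℤ_[p] := ((GaloisRep.cyclotomicCharacter F p h : ℤ_[p]ˣ) : ℤ_[p]) with hχ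
  obtain ⟨hfin1, -⟩ := hD 1 le_rfl 1
  obtain ⟨hfinχ, -⟩ := hD 1 le_rfl χ
  haveI := hfin1
  haveI := hfinχ
  refine ⟨Nat.card ((IwasawaAlgebra p ⧸ Ideal.span {(PowerSeries.X ^ m + PowerSeries.C (p : ℤ_[p]) : IwasawaAlgebra p)}) ⧸
      Ideal.span {Ideal.Quotient.mk (Ideal.span {(PowerSeries.X ^ m + PowerSeries.C (p : ℤ_[p]) : IwasawaAlgebra p)})
        (PowerSeries.C ((1 : ℤ_[p]) ^ 2) + PowerSeries.C (a₁ * 1) * ((1 : IwasawaAlgebra p) + PowerSeries.X) ^ N +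
          PowerSeries.C a₀ * ((1 : IwasawaAlgebra p) + PowerSeries.X) ^ (2 * N))}) ^ 2 *
    Nat.card ((IwasawaAlgebra p ⧸ Ideal.span {(PowerSeries.X ^ m + PowerSeries.C (p : ℤ_[p]) : IwasawaAlgebra p)}) ⧸
      Ideal.span {Ideal.Quotient.mk (Ideal.span {(PowerSeries.X ^ m + PowerSeries.C (p : ℤ_[p]) : IwasawaAlgebra p)})
        (PowerSeries.C (χ ^ 2) + PowerSeries.C (a₁ * χ) * ((1 : IwasawaAlgebra p) + PowerSeries.X) ^ N +
          PowerSeries.C a₀ * ((1 : IwasawaAlgebra p) + PowerSeries.X) ^ (2 * N))}) ^ 2, fun j hj ↦ ?_⟩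
  obtain ⟨-, hb1⟩ := hD j hj 1
  obtain ⟨-, hbχ⟩ := hD j hj χ
  haveI : NeZero (p ^ j) := ⟨pow_ne_zero j hpp.ne_zero⟩
  -- the module, its finiteness and exponent
  set ρ := κ.eisensteinTwist (W.torsionGaloisModule ((p : ℤ) ^ j)) hm j with hρ
  obtain ⟨e⟩ := nonempty_addEquiv_geomTorsion W p j hj hpK
  have hidx : W.geomTorsion ((p ^ j : ℕ) : ℤ) = W.geomTorsion ((p : ℤ) ^ j) := by rw [Nat.cast_pow]
  haveI : Finite (Twisted p m j (W.geomTorsion ((p : ℤ) ^ j))) := by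
    apply Nat.finite_of_card_ne_zero
    rw [Twisted.natCard_eq_of_addEquiv hm ((AddEquiv.addSubgroupCongr hidx).symm.trans e)]
    exact pow_ne_zero _ hpp.ne_zero
  have hM : ∀ w : Twisted p m j (W.geomTorsion ((p : ℤ) ^ j)), p ^ j • w = 0 := Twisted.pow_smul_eq_zero m j
  have hn : ¬ ringChar 𝓀[F] ∣ p ^ j := fun hd ↦ hFp ((ringChar_residueField_prime (F := F)).dvd_of_dvd_pow hd)
  -- Euler characteristic
  haveI := absoluteGaloisGroup_compactSpace F
  have h1 := natCard_one_eq_natCard_invariants_mul F (p ^ j) hn (GaloisRep.restrictField F ρ) hM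
  change Nat.card (continuousCohomology 1 (GaloisRep.restrictField F ρ).toTopRep) ≤ _
  rw [h1]
  refine Nat.mul_le_mul ?_ ?_
  · -- invariants
    refine (natCard_invariants_restrictField_le_natCard_setOf ρ F h).trans ?_
    simpa only [one_pow, mul_one, map_one, one_smul] using hb1
  · -- equivariant characters
    have hc := mu_apply_eq_cyclotomicCharacterModPow_val_nsmul F h (p := p) j
    refine (natCard_invariants_homRep_mu_restrictField_le ρ F h hM hc).trans ?_
    have hcast : ∀ w : Twisted p m j (W.geomTorsion ((p : ℤ) ^ j)),
        (cyclotomicCharacterModPow F p j h).val • w = algebraMap ℤ_[p] (EisensteinCoeff p m j) χ • w := fun w ↦ by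
      rw [EisensteinCoeff.algebraMap_padicInt_eq_ofZMod_toZModPow p hm j, EisensteinCoeff.ofZMod_apply, hχ,
        ← cyclotomicCharacterModPow_apply, Nat.cast_smul_eq_nsmul]
    simp only [hcast, hρ]
    exact hbχ

/-- **`p^c · H¹(F, E[p^j] ⊗ A_{m,j}(ψ)) = 0` for all `j ≥ 1`** (same hypotheses): the local cohomology groups are finite
`p`-primary of bounded order — the inputs (hTX)/(hTY) of the saturated-annihilator descent
`Tower.levelCondition_mem_iff_forall_pairing_eq_zero_of_forall_nsmul_eq_zero` for Howard's `F_𝔮` at `v ∣ N`.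
[cite: Howard2004HeegnerKolyvagin, §1.3 H.4 and Def. 3.1.2] [cite: MilneADT2006, I Thm. 2.8] -/
theorem exists_pow_smul_galoisCohomology_one_restrictField_eisensteinTwist_eq_zero (hpK : (p : K) ≠ 0)
    (hFp : ¬ ringChar 𝓀[F] ∣ p) (h : absoluteGaloisGroup F) {N : ℕ} (hN : 1 ≤ N)
    (hσ : (κ (absGaloisRestrict K F h)).toAdd = (N : ℤ_[p])) (hmN : 2 * N < m) :
    ∃ c : ℕ, ∀ (j : ℕ), 1 ≤ j → ∀ x : galoisCohomology (GaloisRep.restrictField F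
        (κ.eisensteinTwist (W.torsionGaloisModule ((p : ℤ) ^ j)) hm j)) 1, p ^ c • x = 0 := by
  obtain ⟨C, hC⟩ := κ.exists_natCard_galoisCohomology_one_restrictField_eisensteinTwist_le W hm F hpK hFp h hN hσ hmN
  refine ⟨C, fun j hj ↦ ?_⟩
  have hpp := hp.out
  -- the level module is finite (`#(E[p^j] ⊗ A_{m,j}) = p^{2jm}`)
  obtain ⟨e⟩ := nonempty_addEquiv_geomTorsion W p j hj hpK
  have hidx : W.geomTorsion ((p ^ j : ℕ) : ℤ) = W.geomTorsion ((p : ℤ) ^ j) := by rw [Nat.cast_pow]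
  haveI : Finite (Twisted p m j (W.geomTorsion ((p : ℤ) ^ j))) := by
    apply Nat.finite_of_card_ne_zero
    rw [Twisted.natCard_eq_of_addEquiv hm ((AddEquiv.addSubgroupCongr hidx).symm.trans e)]
    exact pow_ne_zero _ hpp.ne_zero
  haveI : Finite (galoisCohomology (GaloisRep.restrictField F
      (κ.eisensteinTwist (W.torsionGaloisModule ((p : ℤ) ^ j)) hm j)) 1) :=
    finite_galoisCohomology_one_of_isNonarchimedeanLocalField _
  have hM : ∀ w : Twisted p m j (W.geomTorsion ((p : ℤ) ^ j)), p ^ j • w = 0 := Twisted.pow_smul_eq_zero m j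
  have hprim : IsPrimaryTorsion p (galoisCohomology (GaloisRep.restrictField F
      (κ.eisensteinTwist (W.torsionGaloisModule ((p : ℤ) ^ j)) hm j)) 1) := fun z ↦
    ⟨j, nsmul_continuousCohomology_one_eq_zero (GaloisRep.restrictField F
      (κ.eisensteinTwist (W.torsionGaloisModule ((p : ℤ) ^ j)) hm j)).toTopRep (p ^ j) hM z⟩
  intro x
  exact Tower.nsmul_eq_zero_of_isPrimaryTorsion_of_natCard_le hpp hprim (hC j hj) x


/-! ## §4 Packaging: finitely decomposed places -/

/-- **If `κ` is non-trivial on the image of `Γ_F`, some `h ∈ Γ_F` has `κ(h) = p^e` exactly**: the image of the compact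
group `Γ_F` in `ℤ_p` is a closed subgroup `p^e ℤ_p` (the tree's `kappa_eq_one_or_exists_image_eq_span_pow`).
[cite: SerreGaloisCohomology1997, I §1.4 (closed subgroups of ℤ_p)] -/
theorem exists_toAdd_apply_absGaloisRestrict_eq_pow (F' : Type u) [Field F'] [Algebra K F']
    (h₀ : absoluteGaloisGroup F') (hh₀ : κ (absGaloisRestrict K F' h₀) ≠ 1) :
    ∃ (e : ℕ) (h : absoluteGaloisGroup F'), (κ (absGaloisRestrict K F' h)).toAdd = ((p ^ e : ℕ) : ℤ_[p]) := by
  haveI := absoluteGaloisGroup_compactSpace F'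
  rcases Literature.GroupTheory.kappa_eq_one_or_exists_image_eq_span_pow
      (κ.toContinuousMonoidHom.comp (absGaloisRestrict K F')) with htriv | ⟨e, -, hsurj⟩
  · exact absurd (htriv h₀) hh₀
  · obtain ⟨h, hh⟩ := hsurj ((p : ℤ_[p]) ^ e) (Ideal.mem_span_singleton_self _)
    refine ⟨e, h, ?_⟩
    rw [Nat.cast_pow]
    exact hh

/-- **Uniform torsion of `H¹(F, E[p^j] ⊗ A_{m,j}(ψ))` from ONE non-trivial value of `κ` on `Γ_F`.**  For a `K`-field `F`,
non-archimedean local of characteristic `0` with residue characteristic `∤ p`, on whose Galois group `κ` is not trivial: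
there is `N ≥ 1` such that for every `m > 2N` some `p^c` kills `H¹(F, E[p^j] ⊗ A_{m,j}(ψ))` for all `j ≥ 1`.
[cite: Howard2004HeegnerKolyvagin, §1.3 H.4, §2.2, Def. 3.1.2] [cite: MilneADT2006, I Thm. 2.8] -/
theorem exists_forall_pow_smul_galoisCohomology_one_eq_zero_of_apply_ne_one (hpK : (p : K) ≠ 0)
    (hFp : ¬ ringChar 𝓀[F] ∣ p) (h₀ : absoluteGaloisGroup F) (hh₀ : κ (absGaloisRestrict K F h₀) ≠ 1) :
    ∃ N : ℕ, 1 ≤ N ∧ ∀ (m : ℕ) (hm : 1 ≤ m), 2 * N < m →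
      ∃ c : ℕ, ∀ (j : ℕ), 1 ≤ j → ∀ x : galoisCohomology (GaloisRep.restrictField F
        (κ.eisensteinTwist (W.torsionGaloisModule ((p : ℤ) ^ j)) hm j)) 1, p ^ c • x = 0 := by
  obtain ⟨e, h, hh⟩ := κ.exists_toAdd_apply_absGaloisRestrict_eq_pow F h₀ hh₀
  refine ⟨p ^ e, Nat.one_le_pow _ _ hp.out.pos, fun m hm hmN ↦ ?_⟩
  exact κ.exists_pow_smul_galoisCohomology_one_restrictField_eisensteinTwist_eq_zero W hm F hpK hFp h
    (Nat.one_le_pow _ _ hp.out.pos) hh hmN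

end ZpExtension

/-! ### At a finite place `v ∤ p` of a number field -/

section AdicCompletion

open IsDedekindDomain NumberField
open scoped NumberField

variable {K : Type} [Field K] [NumberField K] (v : HeightOneSpectrum (𝓞 K))

/-- The residue characteristic of `K_v` does not divide `n` when `(n) ⊄ v` (a private copy of the tree's
`not_ringChar_residueField_adicCompletion_dvd`, whose imports are not wanted here). [folklore] -/
private theorem not_ringChar_residueField_dvd_of_natCast_not_mem' {n : ℕ}
    (hv : ((n : ℕ) : 𝓞 K) ∉ v.asIdeal) : ¬ ringChar 𝓀[v.adicCompletion K] ∣ n := by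
  rintro ⟨m, hm⟩
  set q := ringChar 𝓀[v.adicCompletion K] with hq
  have hqv : ((q : ℕ) : 𝓞 K) ∈ v.asIdeal := by
    by_contra hqv
    have h0 : ((q : ℕ) : 𝓀[v.adicCompletion K]) = 0 := (ringChar.spec 𝓀[v.adicCompletion K] q).2 dvd_rfl
    have h1 : ¬ IsUnit ((q : ℕ) : 𝒪[v.adicCompletion K]) := fun hu ↦ by
      have h' := hu.map (IsLocalRing.residue 𝒪[v.adicCompletion K])
      rw [map_natCast] at h'
      exact h'.ne_zero h0
    rw [Valuation.Integer.not_isUnit_iff_valuation_lt_one] at h1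
    have h2 : Valued.v (((q : ℕ) : 𝒪[v.adicCompletion K]) : v.adicCompletion K) < 1 :=
      (Valuation.vlt_one_iff
        (Valued.v : Valuation (v.adicCompletion K) (WithZero (Multiplicative ℤ)))).mp
        ((Valuation.vlt_one_iff (ValuativeRel.valuation (v.adicCompletion K))).mpr h1)
    have h3 : (((q : ℕ) : 𝒪[v.adicCompletion K]) : v.adicCompletion K) =
        ((algebraMap (𝓞 K) K q : K) : v.adicCompletion K) := by
      rw [SubringClass.coe_natCast, map_natCast]
      exact (map_natCast (algebraMap K (v.adicCompletion K)) q).symm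
    rw [h3, HeightOneSpectrum.valuedAdicCompletion_eq_valuation',
      HeightOneSpectrum.valuation_lt_one_iff_mem] at h2
    exact hqv h2
  apply hv
  have : ((n : ℕ) : 𝓞 K) = ((q : ℕ) : 𝓞 K) * ((m : ℕ) : 𝓞 K) := by rw [hm]; push_cast; ring
  rw [this]
  exact v.asIdeal.mul_mem_right _ hqv

/-- **Uniform torsion of `H¹(K_v, E[p^j] ⊗ A_{m,j}(ψ))` at a finite place `v ∤ p` which does not split completely in
`K_∞`** (`¬ D_v ≤ ker κ`; for `κ` anticyclotomic and `v` split in the imaginary quadratic `K`, the tree's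
`decomp_not_le_kerSubgroup_of_isAnticyclotomic_anyPrime`, Brink 2007): there is `N ≥ 1` such that for every
`m > 2N` some `p^c` kills `H¹(K_v, E[p^j] ⊗ A_{m,j}(ψ))` (`GaloisRep.toLocal v`) for all `j ≥ 1` — the inputs (hTX)/(hTY)
of the saturated descent for Howard's `F_𝔮` at `v ∣ N`. [cite: Howard2004HeegnerKolyvagin, §1.3 H.4, §2.2, Def. 3.1.2]
[cite: MilneADT2006, I Thm. 2.8] [cite: Brink2007, Thm. 2 and Cor. 1] -/
theorem exists_forall_pow_smul_galoisCohomology_one_toLocal_eq_zero (W : WeierstrassCurve K) [W.IsElliptic]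
    {p : ℕ} [hp : Fact p.Prime] (κ : ZpExtension K p) (hv : ((p : ℕ) : 𝓞 K) ∉ v.asIdeal)
    (hdec : ¬ (GreenbergSelmer.decomp v ≤ κ.kerSubgroup)) :
    ∃ N : ℕ, 1 ≤ N ∧ ∀ (m : ℕ) (hm : 1 ≤ m), 2 * N < m →
      ∃ c : ℕ, ∀ (j : ℕ), 1 ≤ j → ∀ x : galoisCohomology (GaloisRep.toLocal v
        (κ.eisensteinTwist (W.torsionGaloisModule ((p : ℤ) ^ j)) hm j)) 1, p ^ c • x = 0 := by
  haveI : CharZero (v.adicCompletion K) :=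
    charZero_of_injective_algebraMap (algebraMap K (v.adicCompletion K)).injective
  have hpK : (p : K) ≠ 0 := Nat.cast_ne_zero.mpr hp.out.ne_zero
  -- an element of `Γ_{K_v}` on which `κ` is non-trivial
  obtain ⟨h₀, hh₀⟩ : ∃ h₀ : absoluteGaloisGroup (v.adicCompletion K),
      κ (absGaloisRestrict K (v.adicCompletion K) h₀) ≠ 1 := by
    by_contra hall
    push Not at hall
    exact hdec fun δ hδ ↦ by
      obtain ⟨σ, rfl⟩ := (GreenbergSelmer.mem_decomp_iff v δ).1 hδ
      exact ZpExtension.mem_kerSubgroup.2 (hall σ)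
  exact κ.exists_forall_pow_smul_galoisCohomology_one_eq_zero_of_apply_ne_one W (v.adicCompletion K) hpK
    (not_ringChar_residueField_dvd_of_natCast_not_mem' v hv) h₀ hh₀

end AdicCompletion

end Literature.NumberTheory.EllipticCurves

end
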